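/-
COR-CM (cell pub-hodgecm2) — Δ2 BRIDGE, ¬hJ LANE (nothj-plan r4 cell «mukey-p2: ONE lemma `nontrivial_Omega_of_hHom`», HOME∕INBOX l.19266;
consumer = F6 HEAD `not_hJ0_of_hodgeBlind_rows_of_hom` (nothj-p4), socket currency `hPN : Nontrivial (…restOne…).Ω` of ✔-desk F3 :148).
THE PLUMBING FROM THE `hHom`-CLASS ROW TO `(P-N)`: a non-zero `φ : Hom_E(A_K, A_μ)_ℚ` at ONE level gives a non-trivial `Ω(μ) = colim_K Hom_E(A_K, A_μ)_ℚ`,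
because at the pin of ANY component-Albanese record `J` the (4.2) map `PΩ` is injective level-wise (✔ `levelwisePin_level_injective`, LAW (v′)).
THEOREMS ONLY; no `def`, no named fact, no `sorry`.  FRAMING: HC_CM is NOT proved; nothing here asserts hJ, hJ₀, hHom or their negations.
-/
import Summits.HodgeConjecture.CorCM.D2Bridge.Map43RecordAtPinLevels
import Literature.NumberTheory.Automorphic.Liu2021.AppendixC.Prop413DataOfRestOne
import HarnessLib

set_option autoImplicit false

/-!
# `Ω(μ) ≠ 0` from one non-zero `Hom_E(A_K, A_μ)_ℚ`, at the pin of a component-Albanese record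

[Liu2021] Y. Liu, *Fourier–Jacobi cycles and arithmetic relative trace formula*, Camb. J. Math. **9** (2021) = arXiv:2102.11518.

* `resOne_ne_zero_of_ne_zero` — for a component-Albanese record `J` of the App.-C datum `C` (any instance `[Algebra L ℂ]`), a tail datum
  `(emb, ιg, μ, hμ, hw, Car)`, the chosen object `Dμ` and a small level `K`: `φ ≠ 0` in `ℚ ⊗ Hom_E(A_K, A_μ)` ⇒ `res_K φ ≠ 0` in `Ω(μ)`
  (✔ `PΩOne_resOne` + ✔ `levelwisePin_level_injective`).
* `nontrivial_ΩOne_of_exists_homQ_ne_zero` — hence `Nontrivial (ΩOne C emb ιg hμ hw Car)`.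
* `nontrivial_Omega_of_hHom` — the same in the [Thm. 4.18]-datum currency of the HEAD: `Nontrivial (toThm418Data C (U.rest (restTailOne emb ιg hμ hw Car rhoΩ))).Ω`
  for every `μ`-uniform family `U` and Hecke action `rhoΩ` (that `Ω` IS `ΩOne`, `rfl`).
The `hHom`-class row of ✔ `D2Bridge/ClosedPrintedMuConjHomNeZero.lean` :87–:96 («∃ K₀ open compact, ∀ K ≤ K₀ open compact, ∃ φ ≠ 0 at `levelOf K`»,
[Liu2021] Thm. 4.18 main clause + (1) existence half, Lem. D.1 (1)) supplies the `φ` at `K := K₀`; the record `J` is the HEAD's own hypothesis `J₁`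
(or the tree's pin at `ῑ₁`).  HC_CM is NOT proved.
-/

noncomputable section

namespace Summit.HodgeConjecture.CorCM.D2Bridge.NotHJ

open CategoryTheory NumberField Function
open Literature.AlgebraicGeometry.Motives (AbelianVariety bettiCohomology)
open Literature.AlgebraicGeometry.HodgeTheory
open Literature.AlgebraicGeometry.ShimuraVarieties.UnitaryCanonicalModel (exists_recordSystem)
open Literature.NumberTheory.Automorphic Literature.NumberTheory.Automorphic.Liu2021 Literature.NumberTheory.Automorphic.Liu2021.AppendixC
open Literature.NumberTheory.Automorphic.Liu2021.AppendixC.RestOne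
open Literature.NumberTheory.Automorphic.PicardCM
open Literature.NumberTheory.Transcendental (Arapura2012_Cor_15_4_6)
open HodgeCM.Model.LevelTranslate HodgeCM.Model.TowerLevel HodgeCM.Model.TowerCarrier

variable {hHD : exists_isReal_hodgeModel} {hI : hodgePQ_independent_of_hodgeModel}
  {hU : BallQuotientUniformisedDatum} {h₃ : CMAbelianVarietyRealised} {hA : Arapura2012_Cor_15_4_6}
  {L : HodgeCM.CMField} {ι₁ : L →+* ℂ} {V : HodgeCM.HermSpace3 L ι₁} {h : exists_recordSystem}
  {Φ : Literature.AlgebraicGeometry.Motives.CMType L} {isotropicAt : ℕ → Prop}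
  {C : Sec42Data (Model.honestP5Of h ⟨L.K⟩ ι₁ ⟨V.Hm, V.isHermitian, V.signature_ι₁, V.posDef_of_ne⟩ Φ) isotropicAt}
  {T : C.HeckeTranslates}

/-- **`res_K φ ≠ 0` in `Ω(μ)` for `φ ≠ 0`** — at the pin of a component-Albanese record `J` the (4.2) map satisfies
`PΩ (res_K φ) = transK ∘ φ^*` (✔ `PΩOne_resOne`) and `φ ↦ transK ∘ φ^*` is injective (✔ `levelwisePin_level_injective`: common denominators,
injectivity of `ofQ`, hom-level detection LAW (v′)); so `res_K φ = 0` forces `φ = 0`.  Nothing asserted inhabited; HC_CM is NOT proved.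
[cite: Liu2021, proof of Thm. 4.18 (FJcycle.tex l. 2248–2266); §4.2 (l. 2070–2072); Rem. 4.17] -/
theorem resOne_ne_zero_of_ne_zero [Algebra L ℂ] (J : ComponentAlbanese hHD hI hU h₃ hA V h Φ C T)
    {Lg : Type} [Field Lg] [NumberField Lg] [IsGalois ℚ Lg] (emb : L →ₐ[ℚ] Lg) (ιg : Lg →+* ℂ)
    {μ : Literature.NumberTheory.Automorphic.IdeleClassGroup L →ₜ* Circle}
    (hμ : Literature.NumberTheory.Automorphic.IdeleClassGroup.IsConjugateSymplectic L μ)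
    (hw : Literature.NumberTheory.Automorphic.IdeleClassGroup.HasWeight L μ 1)
    (Car : Def45.Carriers L μ) (Dμ : ObjOne emb ιg hμ hw Car) (K : C5.SmallLevel C.S.K₀)
    (φ : C.HomQ K (AμOne emb ιg hμ hw Car Dμ)) (hφ : φ ≠ 0) :
    resOne C emb ιg hμ hw Car K Dμ φ ≠ 0 := by
  classical
  intro h0
  apply hφ
  apply levelwisePin_level_injective J emb ιg hμ hw Car Dμ K φ
  rw [← PΩOne_resOne C emb ιg hμ hw Car Dμ (levelwisePin J emb ιg hμ hw Car Dμ) K φ, h0, map_zero]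

/-- **`Ω(μ)` is non-trivial as soon as one `Hom_E(A_K, A_μ)_ℚ` has a non-zero element** (at the pin of any component-Albanese record `J`):
`res_K φ ≠ 0 = res_K 0`.  Nothing asserted inhabited; HC_CM is NOT proved.
[cite: Liu2021, Thm. 4.18 (1) (FJcycle.tex l. 2239) and its proof (l. 2248–2266); Def. 4.16, Rem. 4.17] -/
theorem nontrivial_ΩOne_of_exists_homQ_ne_zero [Algebra L ℂ] (J : ComponentAlbanese hHD hI hU h₃ hA V h Φ C T)
    {Lg : Type} [Field Lg] [NumberField Lg] [IsGalois ℚ Lg] (emb : L →ₐ[ℚ] Lg) (ιg : Lg →+* ℂ)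
    {μ : Literature.NumberTheory.Automorphic.IdeleClassGroup L →ₜ* Circle}
    (hμ : Literature.NumberTheory.Automorphic.IdeleClassGroup.IsConjugateSymplectic L μ)
    (hw : Literature.NumberTheory.Automorphic.IdeleClassGroup.HasWeight L μ 1)
    (Car : Def45.Carriers L μ) (Dμ : ObjOne emb ιg hμ hw Car)
    (hex : ∃ (K : C5.SmallLevel C.S.K₀) (φ : C.HomQ K (AμOne emb ιg hμ hw Car Dμ)), φ ≠ 0) :
    Nontrivial (ΩOne C emb ιg hμ hw Car) := by
  obtain ⟨K, φ, hφ⟩ := hex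
  exact ⟨⟨resOne C emb ιg hμ hw Car K Dμ φ, 0, resOne_ne_zero_of_ne_zero J emb ιg hμ hw Car Dμ K φ hφ⟩⟩

/-- **(P-N) from the `hHom`-class row, in the HEAD's currency**: for every `μ`-uniform family `U` over `C` and every Hecke action `rhoΩ`, the
`Ω` of the [Thm. 4.18] datum `toThm418Data C (U.rest (restTailOne emb ιg hμ hw Car rhoΩ))` IS `ΩOne C emb ιg hμ hw Car` (`rfl`), hence
non-trivial as soon as some `Hom_E(A_K, A_μ)_ℚ` has a non-zero element — the `hHom`-class hypothesis («∃ K₀, ∀ K ≤ K₀, ∃ φ ≠ 0», read at one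
level) — given any component-Albanese record `J` of `C` (in the HEAD: the hypothesis `J₁` itself).  Nothing asserted inhabited; HC_CM is NOT
proved; neither hJ nor hHom is claimed. [cite: Liu2021, Thm. 4.18 (1) (FJcycle.tex l. 2239) and its proof (l. 2248–2266); Def. 4.16, Rem. 4.17] -/
theorem nontrivial_Omega_of_hHom [Algebra L ℂ] (J : ComponentAlbanese hHD hI hU h₃ hA V h Φ C T)
    {Lg : Type} [Field Lg] [NumberField Lg] [IsGalois ℚ Lg] (emb : L →ₐ[ℚ] Lg) (ιg : Lg →+* ℂ)
    {μ : Literature.NumberTheory.Automorphic.IdeleClassGroup L →ₜ* Circle}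
    (hμ : Literature.NumberTheory.Automorphic.IdeleClassGroup.IsConjugateSymplectic L μ)
    (hw : Literature.NumberTheory.Automorphic.IdeleClassGroup.HasWeight L μ 1)
    (Car : Def45.Carriers L μ) (Dμ : ObjOne emb ιg hμ hw Car) (U : UniformOmega C)
    (rhoΩ : Representation (fieldOfValues L μ) C.G (ΩOne C emb ιg hμ hw Car))
    (hex : ∃ (K : C5.SmallLevel C.S.K₀) (φ : C.HomQ K (AμOne emb ιg hμ hw Car Dμ)), φ ≠ 0) :
    Nontrivial (toThm418Data C (U.rest (restTailOne emb ιg hμ hw Car rhoΩ))).Ω :=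
  nontrivial_ΩOne_of_exists_homQ_ne_zero J emb ιg hμ hw Car Dμ hex

end Summit.HodgeConjecture.CorCM.D2Bridge.NotHJ

end
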